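/-
Copyright: the b2b-balaban T⁴-continuum CRUX team, row NE7b OWNER lineage `t4-ne7b-p1` (gen 145). Project licence.
-/
import Summits.QuantumFields.BalabanUV.T4Continuum.Spine.NE7b.SupWeightedTwoPointMastersTwo
import Summits.QuantumFields.BalabanUV.T4Continuum.Spine.NE7b.SupWeightedFourPointTools
import Summits.QuantumFields.BalabanUV.T4Continuum.Spine.NE7b.SupWeightedTreeSixteen

/-!
# THE WEIGHTED FOURTH-ORDER SLOT LETTER, SLOT FOUR (`t` fixed) (SCOPING-d17 (R-c) at order 4; file (665) of (662)–(665)).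
# (648) located the NO: the order-4∕5 class counts supports.  The repair sums the interpolated entry majorant `M₄′` of (655) against the
# full-graph weight `W = Π_{pairs}ϑ` with one index fixed — the OUTPUT slot letter of the weighted class — from weighted INPUT letters only:
# the `ϑ₂`-weighted `K4` letter of this role, the `σ`-profile letters of the `Hk`∕`K3`∕`K4` families (αθ, αθc, αg·m, αg1c, αk4m·, αk4c;
# discharged from intrinsic letters as in (659)), the weighted Hessian letters `hrϑ, hcϑ`, three geometry letters (`G = sup Σϑ⁴∕√ρ`,
# `Θ6 = sup Σϑ⁶∕ϑ₂`, `S4 = sup Σϑ⁴r⁻²`).  ROUTING ((661)): pure `K4` — `ϑ ≤ ϑ₂`; `K4⊗Hk` — crossing power 3 (`ϑ³ ≤ σσ`), group `ϑ₂³`;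
# `K3⊗K3` — crossing power 4 (`ϑ⁴ ≤ σσ`), `ϑ³ ≤ ϑ₂` per pair; interpolated — Hessian edge `ϑ³` (Cauchy–Schwarz against `ϑ₂`: `√(hϑ·Θ6)`),
# `ρ`-edges `ϑ⁴` (`G`), summed leaf-first (`sum3_le`); tree — (660).  NO support letter, NO finite-range hypothesis (row NE7b, node U5c;
# (649), (653), (656), (660), (661) BY NAME; [folklore]).

Cell `pub-balaban`, sub-cell `t4`, spine estimate NE7b (`T4WeightBudget.RelWeightBound`; the cell's OWN estimate — NOT PRINTED in
[Bałaban 1983–89], NOT PROVED).  Crux-route work under `Spine/NE7b/` by the row OWNER (`t4-ne7b-p1` gen 145, file (665)) under FREEZE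
(0)'s crux-prover clause; NOTHING of Bałaban's is named as a Lean object, valued or asserted; no `T4Continuum/Support` leaf typed; no
`def`, no notation (`M₄′` WRITTEN OUT as printed by (655)); zero `sorry`.  Imports (BY NAME): (656), (661), (660) (and (649), (653) through them).

WHAT IS PROVED ([folklore]): **`output_k4ϑ_t`**; toy.

HONEST (what this is NOT).  One slot of four; hypotheses = the weighted-class letters of SCOPING-d17 §D (rates `ϑ³ ≤ ϑ₂`, `ϑ⁴ ≤ σσ`,
`Σϑ⁶∕ϑ₂, Σϑ⁴∕√ρ, Σϑ⁴r⁻² < ∞`; (R-d) and the `αk4·`∕`αg2m` discharges are later files); scalar skeleton ((A3), NC-NE7b-α UNRULED); nothing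
of Bałaban's asserted.  BY-NAME EFFECT ON THE WALL: NONE.  NE7b NOT PRINTED ∕ NOT PROVED; spine PROVED 0∕9; rung (B)+1 — the programme's
measures remain FINITE-torus statements; NOT the mass gap, NOT Clay.  HONEST DEPENDENCY: continuum YM on T⁴ ⇐ BetaPertH ∧ nine spine
estimates (0∕9 proved); BetaPertH ⇐ (D1) ∧ (D4) ∧ CAP+tail; G-an2-4 gates asym, D1 and NE2∕3∕4.
-/

set_option autoImplicit false

noncomputable section

namespace Summit.QuantumFields.BalabanUV.T4Continuum.NE7b.SupWeightedFourthOrderLettersFour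

open Finset Real
open scoped BigOperators
open SupWeightedSlotTools (sum_sqrt_mul_le_letters)
open SupWeightedTwoPointMasters (weighted_two_point_family_le weighted_two_point_family_le')
open SupWeightedTwoPointMastersTwo (weighted_two_point_two_families_le weighted_two_point_two_families_le')
open SupWeightedFourPointTools (route_star34 route_path34 route_cross3 route_cross4 prod6_le sum3_le sum3_perm_132 sum3_perm_213
  sum3_perm_231 sum3_perm_312 interp_pointwise)
open SupWeightedTreeSixteen (weighted_tree16_slot_four)

variable {ι κ : Type} [Fintype ι] [Fintype κ]

variable {Hk : ι → ι → ℝ} {K3 : ι → ι → ι → ℝ} {K4 : ι → ι → ι → ι → ℝ} {A : Matrix ι κ ℝ} {D : κ → κ → ℝ} {ϑ ϑ₂ ρ r : ι → ι → ℝ}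
  {σ : ι → κ → ℝ} {θ : κ → κ → ℝ}
  {γop κ₂ κ₃ lam lamA dθ dθ' αθ βθ αθc αg1m αg2m αg1c αk4m1 αk4m2 αk4m3 αk4c hrϑ hcϑ G Θ6 S4 k4ϑ3 : ℝ}

set_option maxHeartbeats 1600000 in
/-- **WEIGHTED FOURTH-ORDER SLOT LETTER, `t` FIXED** (`t`): the three free indices of `M₄′` ((655)) summed
against the full-graph weight `Π_{6 pairs}ϑ` — fifteen terms: `K4` (input letter `k4ϑ3`), seven two-point terms ((653)∕(656); crossing
power `3`∕`4`), six interpolated terms ((649) weighted Cauchy–Schwarz: `√(h·Θ6)`-letters and the geometry letter `G`), the tree term ((660)).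
[folklore] -/
theorem output_k4ϑ_t (hK40 : ∀ a b c u, 0 ≤ K4 a b c u) (hK30 : ∀ a b u, 0 ≤ K3 a b u) (hHk0 : ∀ v u, 0 ≤ Hk v u) (hD : ∀ x y, 0 ≤ D x y) (hlamA1 :
        lamA < 1)
    (hθnn : ∀ z w, 0 ≤ θ z w) (hDr : ∀ z', ∑ w, D z' w * θ z' w ≤ dθ) (hdθ : 0 ≤ dθ) (hDc : ∀ w, ∑ z', D z' w * θ z' w ≤ dθ') (hdθ' : 0 ≤ dθ')
    (hσ0 : ∀ x w, 0 ≤ σ x w) (hσθ : ∀ x z' w, σ x w ≤ σ x z' * θ z' w)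
    (hϑ1 : ∀ x y, 1 ≤ ϑ x y) (hϑsymm : ∀ x y, ϑ x y = ϑ y x) (hϑmul : ∀ x y z, ϑ x z ≤ ϑ x y * ϑ y z)
    (hϑ₂symm : ∀ x y, ϑ₂ x y = ϑ₂ y x)
    (hϑ3 : ∀ x y, ϑ x y ^ 3 ≤ ϑ₂ x y) (hϑσ : ∀ x y w, ϑ x y ^ 4 ≤ σ x w * σ y w)
    (hρ0 : ∀ x y, 0 < ρ x y)
    (hρsymm : ∀ x y, ρ x y = ρ y x)
    (hG : ∀ a, ∑ b, ϑ a b ^ 4 / Real.sqrt (ρ a b) ≤ G) (hΘ : ∀ a, ∑ b, (ϑ a b ^ 3) ^ 2 / ϑ₂ a b ≤ Θ6)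
    (hhr : ∀ a, ∑ b, ϑ₂ a b * Hk a b ≤ hrϑ)
    (hhc : ∀ a, ∑ b, ϑ₂ a b * Hk b a ≤ hcϑ)
    (hrsymm : ∀ a b, r a b = r b a) (hS4 : ∀ u, ∑ v, ϑ u v ^ 4 * (r u v ^ 2)⁻¹ ≤ S4)
    (hC4 : 0 ≤ (4 * (αθ * dθ * (βθ * dθ') / (1 - lamA)) + 3 * (αθ * dθ * (βθ * dθ') / (1 - lamA)) ^ 2 + 4 * (5 * (κ₂ ^ 4 * γop ^ 2) / (1 - lam *
        γop) ^ 2) + 4 * (50 * (κ₂ ^ 6 * γop ^ 3) / (1 - lam * γop) ^ 3) + 2 * (((5 * (κ₂ ^ 4 * γop ^ 2) / (1 - lam * γop) ^ 2) + 1) / 2) * ((((5 *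
        (κ₂ ^ 4 * γop ^ 2) / (1 - lam * γop) ^ 2) + 1) / 2) + (5 * (κ₂ ^ 4 * γop ^ 2) / (1 - lam * γop) ^ 2))))
    (hbσ : ∀ v, ∑ z', (∑ u, |A u z'| * Hk v u) * σ v z' ≤ αθ)
    (hbσc : ∀ z', ∑ v, (∑ u, |A u z'| * Hk v u) * σ v z' ≤ αθc)
    (hαθc : 0 ≤ αθc)
    (hg2m : ∀ y, ∑ x, ϑ₂ y x * ∑ z', (∑ u, |A u z'| * K3 x y u) * σ y z' ≤ αg2m)
    (hg1c : ∀ z', ∑ x, ∑ y, (∑ u, |A u z'| * K3 x y u) * (σ x z' * ϑ₂ x y) ≤ αg1c)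
    (hαg1c : 0 ≤ αg1c)
    (hk4m3 : ∀ s, ∑ p, ∑ q, (ϑ₂ s p * ϑ₂ s q * ϑ₂ p q) * ∑ z', (∑ u, |A u z'| * K4 p q s u) * σ s z' ≤ αk4m3)
    (hk4c : ∀ z', ∑ a, ∑ b, ∑ c, (∑ u, |A u z'| * K4 a b c u) * (σ a z' * (ϑ₂ a b * ϑ₂ a c * ϑ₂ b c)) ≤ αk4c)
    (hαk4c : 0 ≤ αk4c)
    (hk4 : ∀ t, ∑ x, ∑ y, ∑ z, K4 y z t x * (ϑ₂ x y * ϑ₂ x z * ϑ₂ x t * ϑ₂ y z * ϑ₂ y t * ϑ₂ z t) ≤ k4ϑ3) (t : ι) :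
    ∑ x, ∑ y, ∑ z, (K4 y z t x + ∑ w, (∑ z', D z' w * ∑ u, |A u z'| * K4 x z t u) * (∑ z', D z' w * ∑ u, |A u z'| * Hk y u) / (1 - lamA) + ∑ w, (∑
        z', D z' w * ∑ u, |A u z'| * K4 x y t u) * (∑ z', D z' w * ∑ u, |A u z'| * Hk z u) / (1 - lamA) + ∑ w, (∑ z', D z' w * ∑ u, |A u z'| * K4 x
        y z u) * (∑ z', D z' w * ∑ u, |A u z'| * Hk t u) / (1 - lamA) + ∑ w, (∑ z', D z' w * ∑ u, |A u z'| * Hk x u) * (∑ z', D z' w * ∑ u, |A u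
        z'| * K4 y z t u) / (1 - lamA) + ∑ w, (∑ z', D z' w * ∑ u, |A u z'| * K3 x y u) * (∑ z', D z' w * ∑ u, |A u z'| * K3 z t u) / (1 - lamA) +
        ∑ w, (∑ z', D z' w * ∑ u, |A u z'| * K3 x z u) * (∑ z', D z' w * ∑ u, |A u z'| * K3 y t u) / (1 - lamA) + ∑ w, (∑ z', D z' w * ∑ u, |A u
        z'| * K3 x t u) * (∑ z', D z' w * ∑ u, |A u z'| * K3 y z u) / (1 - lamA) + Real.sqrt (2 * Hk y x * Real.sqrt (5 * (κ₂ ^ 4 * γop ^ 2) / (1 -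
        lam * γop) ^ 2) * (4 * Real.sqrt ((5 * ((κ₂ ^ 4 + κ₃ ^ 4) * γop ^ 2) / (1 - lam * γop) ^ 2) * (αθ * dθ * (βθ * dθ') / (1 - lamA))))) /
        Real.sqrt (ρ x z * ρ x t) + Real.sqrt (2 * Hk z x * Real.sqrt (5 * (κ₂ ^ 4 * γop ^ 2) / (1 - lam * γop) ^ 2) * (4 * Real.sqrt ((5 * ((κ₂ ^
        4 + κ₃ ^ 4) * γop ^ 2) / (1 - lam * γop) ^ 2) * (αθ * dθ * (βθ * dθ') / (1 - lamA))))) / Real.sqrt (ρ x y * ρ x t) + Real.sqrt (2 * Hk t x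
        * Real.sqrt (5 * (κ₂ ^ 4 * γop ^ 2) / (1 - lam * γop) ^ 2) * (4 * Real.sqrt ((5 * ((κ₂ ^ 4 + κ₃ ^ 4) * γop ^ 2) / (1 - lam * γop) ^ 2) *
        (αθ * dθ * (βθ * dθ') / (1 - lamA))))) / Real.sqrt (ρ x y * ρ x z) + Real.sqrt (2 * Hk z y * Real.sqrt (5 * (κ₂ ^ 4 * γop ^ 2) / (1 - lam *
        γop) ^ 2) * (4 * Real.sqrt ((5 * ((κ₂ ^ 4 + κ₃ ^ 4) * γop ^ 2) / (1 - lam * γop) ^ 2) * (αθ * dθ * (βθ * dθ') / (1 - lamA))))) / Real.sqrt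
        (ρ x y * ρ x t) + Real.sqrt (2 * Hk t y * Real.sqrt (5 * (κ₂ ^ 4 * γop ^ 2) / (1 - lam * γop) ^ 2) * (4 * Real.sqrt ((5 * ((κ₂ ^ 4 + κ₃ ^
        4) * γop ^ 2) / (1 - lam * γop) ^ 2) * (αθ * dθ * (βθ * dθ') / (1 - lamA))))) / Real.sqrt (ρ x y * ρ x z) + Real.sqrt (2 * Hk t z *
        Real.sqrt (5 * (κ₂ ^ 4 * γop ^ 2) / (1 - lam * γop) ^ 2) * (4 * Real.sqrt ((5 * ((κ₂ ^ 4 + κ₃ ^ 4) * γop ^ 2) / (1 - lam * γop) ^ 2) * (αθ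
        * dθ * (βθ * dθ') / (1 - lamA))))) / Real.sqrt (ρ x z * ρ x y) + (4 * (αθ * dθ * (βθ * dθ') / (1 - lamA)) + 3 * (αθ * dθ * (βθ * dθ') / (1
        - lamA)) ^ 2 + 4 * (5 * (κ₂ ^ 4 * γop ^ 2) / (1 - lam * γop) ^ 2) + 4 * (50 * (κ₂ ^ 6 * γop ^ 3) / (1 - lam * γop) ^ 3) + 2 * (((5 * (κ₂ ^
        4 * γop ^ 2) / (1 - lam * γop) ^ 2) + 1) / 2) * ((((5 * (κ₂ ^ 4 * γop ^ 2) / (1 - lam * γop) ^ 2) + 1) / 2) + (5 * (κ₂ ^ 4 * γop ^ 2) / (1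
        - lam * γop) ^ 2))) * ((r x y ^ 2)⁻¹ * (r x z ^ 2)⁻¹ * (r x t ^ 2)⁻¹ + (r x y ^ 2)⁻¹ * (r y z ^ 2)⁻¹ * (r y t ^ 2)⁻¹ + (r x z ^ 2)⁻¹ * (r y
        z ^ 2)⁻¹ * (r z t ^ 2)⁻¹ + (r x t ^ 2)⁻¹ * (r y t ^ 2)⁻¹ * (r z t ^ 2)⁻¹ + (r x y ^ 2)⁻¹ * (r y z ^ 2)⁻¹ * (r z t ^ 2)⁻¹ + (r x y ^ 2)⁻¹ *
        (r y t ^ 2)⁻¹ * (r z t ^ 2)⁻¹ + (r x z ^ 2)⁻¹ * (r y z ^ 2)⁻¹ * (r y t ^ 2)⁻¹ + (r x z ^ 2)⁻¹ * (r y t ^ 2)⁻¹ * (r z t ^ 2)⁻¹ + (r x t ^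
        2)⁻¹ * (r y z ^ 2)⁻¹ * (r y t ^ 2)⁻¹ + (r x t ^ 2)⁻¹ * (r y z ^ 2)⁻¹ * (r z t ^ 2)⁻¹ + (r x y ^ 2)⁻¹ * (r x z ^ 2)⁻¹ * (r z t ^ 2)⁻¹ + (r x
        y ^ 2)⁻¹ * (r x t ^ 2)⁻¹ * (r z t ^ 2)⁻¹ + (r x y ^ 2)⁻¹ * (r x z ^ 2)⁻¹ * (r y t ^ 2)⁻¹ + (r x z ^ 2)⁻¹ * (r x t ^ 2)⁻¹ * (r y t ^ 2)⁻¹ +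
        (r x y ^ 2)⁻¹ * (r x t ^ 2)⁻¹ * (r y z ^ 2)⁻¹ + (r x z ^ 2)⁻¹ * (r x t ^ 2)⁻¹ * (r y z ^ 2)⁻¹)) * (ϑ x y * ϑ x z * ϑ x t * ϑ y z * ϑ y t *
        ϑ z t) ≤
      k4ϑ3 + dθ * αk4m3 * (dθ' * αθc) / (1 - lamA) + dθ * αk4m3 * (dθ' * αθc) / (1 - lamA) + dθ * αθ * (dθ' * αk4c) / (1 - lamA) + dθ * αk4m3 *
        (dθ' * αθc) / (1 - lamA) + dθ * αg2m * (dθ' * αg1c) / (1 - lamA) + dθ * αg2m * (dθ' * αg1c) / (1 - lamA) + dθ * αg2m * (dθ' * αg1c) / (1 -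
        lamA) + Real.sqrt (2 * Real.sqrt (5 * (κ₂ ^ 4 * γop ^ 2) / (1 - lam * γop) ^ 2) * (4 * Real.sqrt ((5 * ((κ₂ ^ 4 + κ₃ ^ 4) * γop ^ 2) / (1 -
        lam * γop) ^ 2) * (αθ * dθ * (βθ * dθ') / (1 - lamA))))) * (G * (Real.sqrt (hcϑ * Θ6) * G)) + Real.sqrt (2 * Real.sqrt (5 * (κ₂ ^ 4 * γop ^
        2) / (1 - lam * γop) ^ 2) * (4 * Real.sqrt ((5 * ((κ₂ ^ 4 + κ₃ ^ 4) * γop ^ 2) / (1 - lam * γop) ^ 2) * (αθ * dθ * (βθ * dθ') / (1 -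
        lamA))))) * (G * (G * Real.sqrt (hcϑ * Θ6))) + Real.sqrt (2 * Real.sqrt (5 * (κ₂ ^ 4 * γop ^ 2) / (1 - lam * γop) ^ 2) * (4 * Real.sqrt ((5
        * ((κ₂ ^ 4 + κ₃ ^ 4) * γop ^ 2) / (1 - lam * γop) ^ 2) * (αθ * dθ * (βθ * dθ') / (1 - lamA))))) * (Real.sqrt (hrϑ * Θ6) * (G * G)) +
        Real.sqrt (2 * Real.sqrt (5 * (κ₂ ^ 4 * γop ^ 2) / (1 - lam * γop) ^ 2) * (4 * Real.sqrt ((5 * ((κ₂ ^ 4 + κ₃ ^ 4) * γop ^ 2) / (1 - lam *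
        γop) ^ 2) * (αθ * dθ * (βθ * dθ') / (1 - lamA))))) * (G * (G * Real.sqrt (hcϑ * Θ6))) + Real.sqrt (2 * Real.sqrt (5 * (κ₂ ^ 4 * γop ^ 2) /
        (1 - lam * γop) ^ 2) * (4 * Real.sqrt ((5 * ((κ₂ ^ 4 + κ₃ ^ 4) * γop ^ 2) / (1 - lam * γop) ^ 2) * (αθ * dθ * (βθ * dθ') / (1 - lamA))))) *
        (Real.sqrt (hrϑ * Θ6) * (G * G)) + Real.sqrt (2 * Real.sqrt (5 * (κ₂ ^ 4 * γop ^ 2) / (1 - lam * γop) ^ 2) * (4 * Real.sqrt ((5 * ((κ₂ ^ 4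
        + κ₃ ^ 4) * γop ^ 2) / (1 - lam * γop) ^ 2) * (αθ * dθ * (βθ * dθ') / (1 - lamA))))) * (Real.sqrt (hrϑ * Θ6) * (G * G)) + (4 * (αθ * dθ *
        (βθ * dθ') / (1 - lamA)) + 3 * (αθ * dθ * (βθ * dθ') / (1 - lamA)) ^ 2 + 4 * (5 * (κ₂ ^ 4 * γop ^ 2) / (1 - lam * γop) ^ 2) + 4 * (50 * (κ₂
        ^ 6 * γop ^ 3) / (1 - lam * γop) ^ 3) + 2 * (((5 * (κ₂ ^ 4 * γop ^ 2) / (1 - lam * γop) ^ 2) + 1) / 2) * ((((5 * (κ₂ ^ 4 * γop ^ 2) / (1 -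
        lam * γop) ^ 2) + 1) / 2) + (5 * (κ₂ ^ 4 * γop ^ 2) / (1 - lam * γop) ^ 2))) * (16 * S4 ^ 3) := by
  have hl : 0 < 1 - lamA := by linarith
  have hϑ0 : ∀ a b, 0 ≤ ϑ a b := fun a b => zero_le_one.trans (hϑ1 a b)
  have hϑ₂0 : ∀ a b, 0 ≤ ϑ₂ a b := fun a b => (pow_nonneg (hϑ0 a b) 3).trans (hϑ3 a b)
  have hϑ₂pos : ∀ a b, 0 < ϑ₂ a b := fun a b => lt_of_lt_of_le (pow_pos (lt_of_lt_of_le one_pos (hϑ1 a b)) 3) (hϑ3 a b)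
  have hϑ12 : ∀ a b, ϑ a b ≤ ϑ₂ a b := fun a b => (le_self_pow₀ (hϑ1 a b) (by norm_num)).trans (hϑ3 a b)
  have hϑ3u : ∀ a b, ϑ a b ^ 3 ≤ ϑ₂ a b := hϑ3
  have hϑσ3 : ∀ a b w, ϑ a b ^ 3 ≤ σ a w * σ b w := fun a b w => (pow_le_pow_right₀ (hϑ1 a b) (by norm_num)).trans (hϑσ a b w)
  have hxI : ∀ {c S T I : ℝ}, c ≤ S * T → 0 ≤ I → c * I ≤ S * (T * I) := fun h hI => by
    rw [← mul_assoc]; exact mul_le_mul_of_nonneg_right h hI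
  have hσI : ∀ {S S₁ T I : ℝ}, S ≤ S₁ * T → 0 ≤ I → S * I ≤ S₁ * I * T := fun h hI => by
    rw [mul_right_comm]; exact mul_le_mul_of_nonneg_right h hI
  have hI3 : ∀ a b c, 0 ≤ ϑ₂ a b * ϑ₂ a c * ϑ₂ b c := fun a b c => mul_nonneg (mul_nonneg (hϑ₂0 a b) (hϑ₂0 a c)) (hϑ₂0 b c)
  have hF2 : ∀ a z', 0 ≤ ∑ u, |A u z'| * Hk a u := fun a z' => sum_nonneg fun u _ => mul_nonneg (abs_nonneg _) (hHk0 a u)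
  have hF3 : ∀ a b z', 0 ≤ ∑ u, |A u z'| * K3 a b u := fun a b z' => sum_nonneg fun u _ => mul_nonneg (abs_nonneg _) (hK30 a b u)
  have hF4 : ∀ a b c z', 0 ≤ ∑ u, |A u z'| * K4 a b c u := fun a b c z' => sum_nonneg fun u _ => mul_nonneg (abs_nonneg _) (hK40 a b c u)
  have hE : ∀ {F G : κ → ℝ}, (∀ z', 0 ≤ F z') → (∀ z', 0 ≤ G z') →
      0 ≤ ∑ w, (∑ z', D z' w * F z') * (∑ z', D z' w * G z') / (1 - lamA) := fun hF hG => sum_nonneg fun w _ =>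
    div_nonneg (mul_nonneg (sum_nonneg fun z' _ => mul_nonneg (hD z' w) (hF z')) (sum_nonneg fun z' _ => mul_nonneg (hD z' w) (hG z'))) hl.le
  have hm00 : ∀ a c b, ϑ a b ≤ ϑ a c * ϑ c b := fun a c b => hϑmul a c b
  have hm10 : ∀ a c b, ϑ a b ≤ ϑ c a * ϑ c b := fun a c b => by rw [hϑsymm c a]; exact hϑmul a c b
  have hm01 : ∀ a c b, ϑ a b ≤ ϑ a c * ϑ b c := fun a c b => by rw [hϑsymm b c]; exact hϑmul a c b
  have hG0 : 0 ≤ G := le_trans (sum_nonneg fun b _ => div_nonneg (pow_nonneg (hϑ0 _ _) 4) (Real.sqrt_nonneg _)) (hG t)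
  have hϑ2 : ∀ a b, ϑ a b ^ 2 ≤ ϑ₂ a b := fun a b => (pow_le_pow_right₀ (hϑ1 a b) (by norm_num)).trans (hϑ3 a b)
  have hϑ2r : ∀ a b, ϑ a b ^ 2 ≤ ϑ₂ b a := fun a b => by rw [hϑ₂symm b a]; exact (pow_le_pow_right₀ (hϑ1 a b) (by norm_num)).trans (hϑ3 a b)
  have hϑ3r : ∀ a b, ϑ a b ^ 3 ≤ ϑ₂ b a := fun a b => by rw [hϑ₂symm b a]; exact hϑ3 a b
  have hϑσ3r : ∀ a b w, ϑ a b ^ 3 ≤ σ b w * σ a w := fun a b w => by rw [mul_comm]; exact hϑσ3 a b w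
  have hϑσ4r : ∀ a b w, ϑ a b ^ 4 ≤ σ b w * σ a w := fun a b w => by rw [mul_comm]; exact hϑσ a b w
  have hGr : ∀ a, ∑ b, ϑ b a ^ 4 / Real.sqrt (ρ b a) ≤ G := fun a => by simp_rw [hϑsymm _ a, hρsymm _ a]; exact hG a
  have hΘr : ∀ a, ∑ b, (ϑ b a ^ 3) ^ 2 / ϑ₂ b a ≤ Θ6 := fun a => by simp_rw [hϑsymm _ a, hϑ₂symm _ a]; exact hΘ a
  have hhrr : ∀ a, ∑ b, ϑ₂ b a * Hk a b ≤ hrϑ := fun a => by simp_rw [hϑ₂symm _ a]; exact hhr a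
  have hCt : 0 ≤ (4 * (αθ * dθ * (βθ * dθ') / (1 - lamA)) + 3 * (αθ * dθ * (βθ * dθ') / (1 - lamA)) ^ 2 + 4 * (5 * (κ₂ ^ 4 * γop ^ 2) / (1 - lam *
        γop) ^ 2) + 4 * (50 * (κ₂ ^ 6 * γop ^ 3) / (1 - lam * γop) ^ 3) + 2 * (((5 * (κ₂ ^ 4 * γop ^ 2) / (1 - lam * γop) ^ 2) + 1) / 2) * ((((5 *
        (κ₂ ^ 4 * γop ^ 2) / (1 - lam * γop) ^ 2) + 1) / 2) + (5 * (κ₂ ^ 4 * γop ^ 2) / (1 - lam * γop) ^ 2))) := hC4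
  have hQ4 : 0 ≤ (4 * Real.sqrt ((5 * ((κ₂ ^ 4 + κ₃ ^ 4) * γop ^ 2) / (1 - lam * γop) ^ 2) * (αθ * dθ * (βθ * dθ') / (1 - lamA)))) := by positivity
  have hsV : 0 ≤ Real.sqrt (5 * (κ₂ ^ 4 * γop ^ 2) / (1 - lam * γop) ^ 2) := Real.sqrt_nonneg _
  generalize (4 * (αθ * dθ * (βθ * dθ') / (1 - lamA)) + 3 * (αθ * dθ * (βθ * dθ') / (1 - lamA)) ^ 2 + 4 * (5 * (κ₂ ^ 4 * γop ^ 2) / (1 - lam * γop)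
        ^ 2) + 4 * (50 * (κ₂ ^ 6 * γop ^ 3) / (1 - lam * γop) ^ 3) + 2 * (((5 * (κ₂ ^ 4 * γop ^ 2) / (1 - lam * γop) ^ 2) + 1) / 2) * ((((5 * (κ₂ ^
        4 * γop ^ 2) / (1 - lam * γop) ^ 2) + 1) / 2) + (5 * (κ₂ ^ 4 * γop ^ 2) / (1 - lam * γop) ^ 2))) = Ct at hCt ⊢
  generalize (4 * Real.sqrt ((5 * ((κ₂ ^ 4 + κ₃ ^ 4) * γop ^ 2) / (1 - lam * γop) ^ 2) * (αθ * dθ * (βθ * dθ') / (1 - lamA)))) = Q4 at hQ4 ⊢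
  generalize Real.sqrt (5 * (κ₂ ^ 4 * γop ^ 2) / (1 - lam * γop) ^ 2) = sV at hsV ⊢
  have hKc : 0 ≤ 2 * sV * Q4 := by positivity
  have h0 : ∑ x, ∑ y, ∑ z, (K4 y z t x) * (ϑ x y * ϑ x z * ϑ x t * ϑ y z * ϑ y t * ϑ z t) ≤ k4ϑ3 := by
    exact (sum_le_sum fun x _ => sum_le_sum fun y _ => sum_le_sum fun z _ => mul_le_mul_of_nonneg_left (prod6_le (hϑ12 x y) (hϑ12 x z) (hϑ12 x t)
        (hϑ12 y z) (hϑ12 y t) (hϑ12 z t) (hϑ0 x y) (hϑ0 x z) (hϑ0 x t) (hϑ0 y z) (hϑ0 y t) (hϑ0 z t)) (hK40 y z t x)).trans (hk4 t)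
  have h1 : ∑ x, ∑ y, ∑ z, (∑ w, (∑ z', D z' w * ∑ u, |A u z'| * K4 x z t u) * (∑ z', D z' w * ∑ u, |A u z'| * Hk y u) / (1 - lamA)) * (ϑ x y * ϑ x
        z * ϑ x t * ϑ y z * ϑ y t * ϑ z t) ≤ dθ * αk4m3 * (dθ' * αθc) / (1 - lamA) := by
    have h := weighted_two_point_two_families_le' (R := ι × ι) (S := ι) (αm := αk4m3) (g := fun r z' => ∑ u, |A u z'| * K4 r.1 r.2 t u) (α := fun r
        => ϑ₂ t r.1 * ϑ₂ t r.2 * ϑ₂ r.1 r.2) (b := fun yy z' => ∑ u, |A u z'| * Hk yy u) (σ := fun w => σ t w) (σ₁ := fun z' => σ t z') (σ' := fun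
        yy w => σ yy w) (σ'₁ := fun yy z' => σ yy z') (β := fun yy => ϑ yy t ^ 3) (fun r z' => hF4 r.1 r.2 t z') (fun r => hI3 t r.1 r.2) (fun yy
        z' => hF2 yy z') hD hθnn (fun w => hσ0 t w) (fun z' => hσ0 t z') (fun yy w => hϑσ3r yy t w) (fun z' w => hσθ t z' w) (fun yy z' w => hσθ yy
        z' w) hDr hdθ hDc hdθ' (by rw [Fintype.sum_prod_type]; exact hk4m3 t) hbσc hαθc hlamA1
    rw [Fintype.sum_prod_type] at h
    refine (sum3_perm_132 Finset.univ fun x y z => (∑ w, (∑ z', D z' w * ∑ u, |A u z'| * K4 x z t u) * (∑ z', D z' w * ∑ u, |A u z'| * Hk y u) / (1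
        - lamA)) * (ϑ x y * ϑ x z * ϑ x t * ϑ y z * ϑ y t * ϑ z t)).trans_le ?_
    refine le_trans ?_ h
    exact sum_le_sum fun x _ => sum_le_sum fun z _ => sum_le_sum fun y _ =>
      show (∑ w, (∑ z', D z' w * ∑ u, |A u z'| * K4 x z t u) * (∑ z', D z' w * ∑ u, |A u z'| * Hk y u) / (1 - lamA)) * (ϑ x y * ϑ x z * ϑ x t * ϑ y
        z * ϑ y t * ϑ z t) ≤ (∑ w, (∑ z', D z' w * ∑ u, |A u z'| * K4 x z t u) * (∑ z', D z' w * ∑ u, |A u z'| * Hk y u) / (1 - lamA)) * (ϑ₂ t x *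
        ϑ₂ t z * ϑ₂ x z * ϑ y t ^ 3) from mul_le_mul_of_nonneg_left ((Eq.trans_le (by ring) (route_cross3 (hϑ0 y t) (hϑ0 x t) (hϑ0 z t) (hϑ0 x z)
        (hϑ0 y z) (((hm01 x t y)).trans_eq (by ring)) (hm01 y t z) (hϑ2r x t) (hϑ2r z t) (hϑ12 x z))).trans_eq (mul_comm _ _)) (hE (hF4 x z t) (hF2
        y))
  have h2 : ∑ x, ∑ y, ∑ z, (∑ w, (∑ z', D z' w * ∑ u, |A u z'| * K4 x y t u) * (∑ z', D z' w * ∑ u, |A u z'| * Hk z u) / (1 - lamA)) * (ϑ x y * ϑ x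
        z * ϑ x t * ϑ y z * ϑ y t * ϑ z t) ≤ dθ * αk4m3 * (dθ' * αθc) / (1 - lamA) := by
    have h := weighted_two_point_two_families_le' (R := ι × ι) (S := ι) (αm := αk4m3) (g := fun r z' => ∑ u, |A u z'| * K4 r.1 r.2 t u) (α := fun r
        => ϑ₂ t r.1 * ϑ₂ t r.2 * ϑ₂ r.1 r.2) (b := fun yy z' => ∑ u, |A u z'| * Hk yy u) (σ := fun w => σ t w) (σ₁ := fun z' => σ t z') (σ' := fun
        yy w => σ yy w) (σ'₁ := fun yy z' => σ yy z') (β := fun yy => ϑ yy t ^ 3) (fun r z' => hF4 r.1 r.2 t z') (fun r => hI3 t r.1 r.2) (fun yy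
        z' => hF2 yy z') hD hθnn (fun w => hσ0 t w) (fun z' => hσ0 t z') (fun yy w => hϑσ3r yy t w) (fun z' w => hσθ t z' w) (fun yy z' w => hσθ yy
        z' w) hDr hdθ hDc hdθ' (by rw [Fintype.sum_prod_type]; exact hk4m3 t) hbσc hαθc hlamA1
    rw [Fintype.sum_prod_type] at h
    refine le_trans ?_ h
    exact sum_le_sum fun x _ => sum_le_sum fun y _ => sum_le_sum fun z _ =>
      show (∑ w, (∑ z', D z' w * ∑ u, |A u z'| * K4 x y t u) * (∑ z', D z' w * ∑ u, |A u z'| * Hk z u) / (1 - lamA)) * (ϑ x y * ϑ x z * ϑ x t * ϑ y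
        z * ϑ y t * ϑ z t) ≤ (∑ w, (∑ z', D z' w * ∑ u, |A u z'| * K4 x y t u) * (∑ z', D z' w * ∑ u, |A u z'| * Hk z u) / (1 - lamA)) * (ϑ₂ t x *
        ϑ₂ t y * ϑ₂ x y * ϑ z t ^ 3) from mul_le_mul_of_nonneg_left ((Eq.trans_le (by ring) (route_cross3 (hϑ0 z t) (hϑ0 x t) (hϑ0 y t) (hϑ0 x y)
        (hϑ0 y z) (((hm01 x t z)).trans_eq (by ring)) (((hm01 y t z)).trans_eq (by ring)) (hϑ2r x t) (hϑ2r y t) (hϑ12 x y))).trans_eq (mul_comm _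
        _)) (hE (hF4 x y t) (hF2 z))
  have h3 : ∑ x, ∑ y, ∑ z, (∑ w, (∑ z', D z' w * ∑ u, |A u z'| * K4 x y z u) * (∑ z', D z' w * ∑ u, |A u z'| * Hk t u) / (1 - lamA)) * (ϑ x y * ϑ x
        z * ϑ x t * ϑ y z * ϑ y t * ϑ z t) ≤ dθ * αθ * (dθ' * αk4c) / (1 - lamA) := by
    have h := weighted_two_point_family_le (R := ι × ι × ι) (a := fun z' => ∑ u, |A u z'| * Hk t u) (b := fun q z' => ∑ u, |A u z'| * K4 q.1 q.2.1
        q.2.2 u) (σ := fun w => σ t w) (σ₁ := fun z' => σ t z') (σ' := fun q w => σ q.1 w * (ϑ₂ q.1 q.2.1 * ϑ₂ q.1 q.2.2 * ϑ₂ q.2.1 q.2.2)) (σ'₁ :=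
        fun q z' => σ q.1 z' * (ϑ₂ q.1 q.2.1 * ϑ₂ q.1 q.2.2 * ϑ₂ q.2.1 q.2.2)) (ϑ := fun q => ϑ q.1 t ^ 3 * (ϑ₂ q.1 q.2.1 * ϑ₂ q.1 q.2.2 * ϑ₂ q.2.1
        q.2.2)) (fun z' => hF2 t z') (fun q z' => hF4 q.1 q.2.1 q.2.2 z') hD hθnn (fun w => hσ0 t w) (fun z' => hσ0 t z') (fun q w => hxI (hϑσ3r
        q.1 t w) (hI3 q.1 q.2.1 q.2.2)) (fun z' w => hσθ t z' w) (fun q z' w => hσI (hσθ q.1 z' w) (hI3 q.1 q.2.1 q.2.2)) hDr hdθ hDc hdθ' (hbσ t)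
        (fun z' => by simp only [Fintype.sum_prod_type]; exact hk4c z') hαk4c hlamA1
    simp only [Fintype.sum_prod_type] at h
    refine le_trans ?_ h
    exact sum_le_sum fun x _ => sum_le_sum fun y _ => sum_le_sum fun z _ =>
      show (∑ w, (∑ z', D z' w * ∑ u, |A u z'| * K4 x y z u) * (∑ z', D z' w * ∑ u, |A u z'| * Hk t u) / (1 - lamA)) * (ϑ x y * ϑ x z * ϑ x t * ϑ y
        z * ϑ y t * ϑ z t) ≤ (∑ w, (∑ z', D z' w * ∑ u, |A u z'| * K4 x y z u) * (∑ z', D z' w * ∑ u, |A u z'| * Hk t u) / (1 - lamA)) * (ϑ x t ^ 3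
        * (ϑ₂ x y * ϑ₂ x z * ϑ₂ y z)) from mul_le_mul_of_nonneg_left (Eq.trans_le (by ring) (route_cross3 (hϑ0 x t) (hϑ0 x y) (hϑ0 x z) (hϑ0 y z)
        (hϑ0 z t) (((hm10 y x t)).trans_eq (by ring)) (((hm10 z x t)).trans_eq (by ring)) (hϑ2 x y) (hϑ2 x z) (hϑ12 y z))) (hE (hF4 x y z) (hF2 t))
  have h4 : ∑ x, ∑ y, ∑ z, (∑ w, (∑ z', D z' w * ∑ u, |A u z'| * Hk x u) * (∑ z', D z' w * ∑ u, |A u z'| * K4 y z t u) / (1 - lamA)) * (ϑ x y * ϑ x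
        z * ϑ x t * ϑ y z * ϑ y t * ϑ z t) ≤ dθ * αk4m3 * (dθ' * αθc) / (1 - lamA) := by
    have h := weighted_two_point_two_families_le (R := ι × ι) (S := ι) (αm := αk4m3) (g := fun r z' => ∑ u, |A u z'| * K4 r.1 r.2 t u) (α := fun r
        => ϑ₂ t r.1 * ϑ₂ t r.2 * ϑ₂ r.1 r.2) (b := fun yy z' => ∑ u, |A u z'| * Hk yy u) (σ := fun w => σ t w) (σ₁ := fun z' => σ t z') (σ' := fun
        yy w => σ yy w) (σ'₁ := fun yy z' => σ yy z') (β := fun yy => ϑ yy t ^ 3) (fun r z' => hF4 r.1 r.2 t z') (fun r => hI3 t r.1 r.2) (fun yy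
        z' => hF2 yy z') hD hθnn (fun w => hσ0 t w) (fun z' => hσ0 t z') (fun yy w => hϑσ3r yy t w) (fun z' w => hσθ t z' w) (fun yy z' w => hσθ yy
        z' w) hDr hdθ hDc hdθ' (by rw [Fintype.sum_prod_type]; exact hk4m3 t) hbσc hαθc hlamA1
    rw [Fintype.sum_prod_type] at h
    refine (sum3_perm_231 Finset.univ fun x y z => (∑ w, (∑ z', D z' w * ∑ u, |A u z'| * Hk x u) * (∑ z', D z' w * ∑ u, |A u z'| * K4 y z t u) / (1
        - lamA)) * (ϑ x y * ϑ x z * ϑ x t * ϑ y z * ϑ y t * ϑ z t)).trans_le ?_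
    refine le_trans ?_ h
    exact sum_le_sum fun y _ => sum_le_sum fun z _ => sum_le_sum fun x _ =>
      show (∑ w, (∑ z', D z' w * ∑ u, |A u z'| * Hk x u) * (∑ z', D z' w * ∑ u, |A u z'| * K4 y z t u) / (1 - lamA)) * (ϑ x y * ϑ x z * ϑ x t * ϑ y
        z * ϑ y t * ϑ z t) ≤ (∑ w, (∑ z', D z' w * ∑ u, |A u z'| * Hk x u) * (∑ z', D z' w * ∑ u, |A u z'| * K4 y z t u) / (1 - lamA)) * (ϑ₂ t y *
        ϑ₂ t z * ϑ₂ y z * ϑ x t ^ 3) from mul_le_mul_of_nonneg_left ((Eq.trans_le (by ring) (route_cross3 (hϑ0 x t) (hϑ0 y t) (hϑ0 z t) (hϑ0 y z)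
        (hϑ0 x z) (hm01 x t y) (hm01 x t z) (hϑ2r y t) (hϑ2r z t) (hϑ12 y z))).trans_eq (mul_comm _ _)) (hE (hF2 x) (hF4 y z t))
  have h5 : ∑ x, ∑ y, ∑ z, (∑ w, (∑ z', D z' w * ∑ u, |A u z'| * K3 x y u) * (∑ z', D z' w * ∑ u, |A u z'| * K3 z t u) / (1 - lamA)) * (ϑ x y * ϑ x
        z * ϑ x t * ϑ y z * ϑ y t * ϑ z t) ≤ dθ * αg2m * (dθ' * αg1c) / (1 - lamA) := by
    have h := weighted_two_point_two_families_le (R := ι) (S := ι × ι) (g := fun pp z' => ∑ u, |A u z'| * K3 pp t u) (α := fun pp => ϑ₂ t pp) (b :=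
        fun q z' => ∑ u, |A u z'| * K3 q.1 q.2 u) (σ := fun w => σ t w) (σ₁ := fun z' => σ t z') (σ' := fun q w => σ q.1 w * ϑ₂ q.1 q.2) (σ'₁ :=
        fun q z' => σ q.1 z' * ϑ₂ q.1 q.2) (β := fun q => ϑ q.1 t ^ 4 * ϑ₂ q.1 q.2) (fun pp z' => hF3 pp t z') (fun pp => hϑ₂0 t pp) (fun q z' =>
        hF3 q.1 q.2 z') hD hθnn (fun w => hσ0 t w) (fun z' => hσ0 t z') (fun q w => hxI (hϑσ4r q.1 t w) (hϑ₂0 q.1 q.2)) (fun z' w => hσθ t z' w)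
        (fun q z' w => hσI (hσθ q.1 z' w) (hϑ₂0 q.1 q.2)) hDr hdθ hDc hdθ' (hg2m t) (fun z' => by rw [Fintype.sum_prod_type]; exact hg1c z') hαg1c
        hlamA1
    simp only [Fintype.sum_prod_type] at h
    refine (sum3_perm_312 Finset.univ fun x y z => (∑ w, (∑ z', D z' w * ∑ u, |A u z'| * K3 x y u) * (∑ z', D z' w * ∑ u, |A u z'| * K3 z t u) / (1
        - lamA)) * (ϑ x y * ϑ x z * ϑ x t * ϑ y z * ϑ y t * ϑ z t)).trans_le ?_
    refine le_trans ?_ h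
    exact sum_le_sum fun z _ => sum_le_sum fun x _ => sum_le_sum fun y _ =>
      show (∑ w, (∑ z', D z' w * ∑ u, |A u z'| * K3 x y u) * (∑ z', D z' w * ∑ u, |A u z'| * K3 z t u) / (1 - lamA)) * (ϑ x y * ϑ x z * ϑ x t * ϑ y
        z * ϑ y t * ϑ z t) ≤ (∑ w, (∑ z', D z' w * ∑ u, |A u z'| * K3 x y u) * (∑ z', D z' w * ∑ u, |A u z'| * K3 z t u) / (1 - lamA)) * (ϑ₂ t z *
        (ϑ x t ^ 4 * ϑ₂ x y)) from mul_le_mul_of_nonneg_left (Eq.trans_le (by ring) (route_cross4 (hϑ0 x t) (hϑ0 z t) (hϑ0 x y) (hϑ0 y t) (hϑ0 y z)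
        (hm01 x t z) (((hm10 y x t)).trans_eq (by ring)) ((((hm01 y t z).trans (mul_le_mul_of_nonneg_right (hm10 y x t) (hϑ0 _ _)))).trans_eq (by
        ring)) (hϑ3r z t) (hϑ3u x y))) (hE (hF3 x y) (hF3 z t))
  have h6 : ∑ x, ∑ y, ∑ z, (∑ w, (∑ z', D z' w * ∑ u, |A u z'| * K3 x z u) * (∑ z', D z' w * ∑ u, |A u z'| * K3 y t u) / (1 - lamA)) * (ϑ x y * ϑ x
        z * ϑ x t * ϑ y z * ϑ y t * ϑ z t) ≤ dθ * αg2m * (dθ' * αg1c) / (1 - lamA) := by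
    have h := weighted_two_point_two_families_le (R := ι) (S := ι × ι) (g := fun pp z' => ∑ u, |A u z'| * K3 pp t u) (α := fun pp => ϑ₂ t pp) (b :=
        fun q z' => ∑ u, |A u z'| * K3 q.1 q.2 u) (σ := fun w => σ t w) (σ₁ := fun z' => σ t z') (σ' := fun q w => σ q.1 w * ϑ₂ q.1 q.2) (σ'₁ :=
        fun q z' => σ q.1 z' * ϑ₂ q.1 q.2) (β := fun q => ϑ q.1 t ^ 4 * ϑ₂ q.1 q.2) (fun pp z' => hF3 pp t z') (fun pp => hϑ₂0 t pp) (fun q z' =>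
        hF3 q.1 q.2 z') hD hθnn (fun w => hσ0 t w) (fun z' => hσ0 t z') (fun q w => hxI (hϑσ4r q.1 t w) (hϑ₂0 q.1 q.2)) (fun z' w => hσθ t z' w)
        (fun q z' w => hσI (hσθ q.1 z' w) (hϑ₂0 q.1 q.2)) hDr hdθ hDc hdθ' (hg2m t) (fun z' => by rw [Fintype.sum_prod_type]; exact hg1c z') hαg1c
        hlamA1
    simp only [Fintype.sum_prod_type] at h
    refine (sum3_perm_213 Finset.univ fun x y z => (∑ w, (∑ z', D z' w * ∑ u, |A u z'| * K3 x z u) * (∑ z', D z' w * ∑ u, |A u z'| * K3 y t u) / (1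
        - lamA)) * (ϑ x y * ϑ x z * ϑ x t * ϑ y z * ϑ y t * ϑ z t)).trans_le ?_
    refine le_trans ?_ h
    exact sum_le_sum fun y _ => sum_le_sum fun x _ => sum_le_sum fun z _ =>
      show (∑ w, (∑ z', D z' w * ∑ u, |A u z'| * K3 x z u) * (∑ z', D z' w * ∑ u, |A u z'| * K3 y t u) / (1 - lamA)) * (ϑ x y * ϑ x z * ϑ x t * ϑ y
        z * ϑ y t * ϑ z t) ≤ (∑ w, (∑ z', D z' w * ∑ u, |A u z'| * K3 x z u) * (∑ z', D z' w * ∑ u, |A u z'| * K3 y t u) / (1 - lamA)) * (ϑ₂ t y *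
        (ϑ x t ^ 4 * ϑ₂ x z)) from mul_le_mul_of_nonneg_left (Eq.trans_le (by ring) (route_cross4 (hϑ0 x t) (hϑ0 y t) (hϑ0 x z) (hϑ0 z t) (hϑ0 y z)
        (hm01 x t y) (((hm10 z x t)).trans_eq (by ring)) ((((hm01 y t z).trans (mul_le_mul_of_nonneg_left (hm10 z x t) (hϑ0 _ _)))).trans_eq (by
        ring)) (hϑ3r y t) (hϑ3u x z))) (hE (hF3 x z) (hF3 y t))
  have h7 : ∑ x, ∑ y, ∑ z, (∑ w, (∑ z', D z' w * ∑ u, |A u z'| * K3 x t u) * (∑ z', D z' w * ∑ u, |A u z'| * K3 y z u) / (1 - lamA)) * (ϑ x y * ϑ x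
        z * ϑ x t * ϑ y z * ϑ y t * ϑ z t) ≤ dθ * αg2m * (dθ' * αg1c) / (1 - lamA) := by
    have h := weighted_two_point_two_families_le' (R := ι) (S := ι × ι) (g := fun pp z' => ∑ u, |A u z'| * K3 pp t u) (α := fun pp => ϑ₂ t pp) (b
        := fun q z' => ∑ u, |A u z'| * K3 q.1 q.2 u) (σ := fun w => σ t w) (σ₁ := fun z' => σ t z') (σ' := fun q w => σ q.1 w * ϑ₂ q.1 q.2) (σ'₁ :=
        fun q z' => σ q.1 z' * ϑ₂ q.1 q.2) (β := fun q => ϑ q.1 t ^ 4 * ϑ₂ q.1 q.2) (fun pp z' => hF3 pp t z') (fun pp => hϑ₂0 t pp) (fun q z' =>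
        hF3 q.1 q.2 z') hD hθnn (fun w => hσ0 t w) (fun z' => hσ0 t z') (fun q w => hxI (hϑσ4r q.1 t w) (hϑ₂0 q.1 q.2)) (fun z' w => hσθ t z' w)
        (fun q z' w => hσI (hσθ q.1 z' w) (hϑ₂0 q.1 q.2)) hDr hdθ hDc hdθ' (hg2m t) (fun z' => by rw [Fintype.sum_prod_type]; exact hg1c z') hαg1c
        hlamA1
    simp only [Fintype.sum_prod_type] at h
    refine le_trans ?_ h
    exact sum_le_sum fun x _ => sum_le_sum fun y _ => sum_le_sum fun z _ =>
      show (∑ w, (∑ z', D z' w * ∑ u, |A u z'| * K3 x t u) * (∑ z', D z' w * ∑ u, |A u z'| * K3 y z u) / (1 - lamA)) * (ϑ x y * ϑ x z * ϑ x t * ϑ y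
        z * ϑ y t * ϑ z t) ≤ (∑ w, (∑ z', D z' w * ∑ u, |A u z'| * K3 x t u) * (∑ z', D z' w * ∑ u, |A u z'| * K3 y z u) / (1 - lamA)) * (ϑ₂ t x *
        (ϑ y t ^ 4 * ϑ₂ y z)) from mul_le_mul_of_nonneg_left (Eq.trans_le (by ring) (route_cross4 (hϑ0 y t) (hϑ0 x t) (hϑ0 y z) (hϑ0 z t) (hϑ0 x z)
        (((hm01 x t y)).trans_eq (by ring)) (((hm10 z y t)).trans_eq (by ring)) ((((hm01 x t z).trans (mul_le_mul_of_nonneg_left (hm10 z y t) (hϑ0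
        _ _)))).trans_eq (by ring)) (hϑ3r x t) (hϑ3u y z))) (hE (hF3 x t) (hF3 y z))
  have h8 : ∑ x, ∑ y, ∑ z, (Real.sqrt (2 * Hk y x * sV * Q4) / Real.sqrt (ρ x z * ρ x t)) * (ϑ x y * ϑ x z * ϑ x t * ϑ y z * ϑ y t * ϑ z t) ≤
        Real.sqrt (2 * sV * Q4) * (G * (Real.sqrt (hcϑ * Θ6) * G)) := by
    refine le_trans ?_ (sum3_le (K := Real.sqrt (2 * sV * Q4)) (a := fun x => ϑ x t ^ 4 / Real.sqrt (ρ x t)) (b := fun x y => Real.sqrt (Hk y x) *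
        ϑ x y ^ 3) (c := fun x y z => ϑ x z ^ 4 / Real.sqrt (ρ x z)) (Real.sqrt_nonneg _) (fun x => div_nonneg (pow_nonneg (hϑ0 x t) 4)
        (Real.sqrt_nonneg _)) (fun x y => mul_nonneg (Real.sqrt_nonneg _) (pow_nonneg (hϑ0 x y) 3)) (Real.sqrt_nonneg _) hG0 (hGr t) (fun x =>
        sum_sqrt_mul_le_letters Finset.univ (a := fun y => Hk y x) (c := fun y => ϑ x y ^ 3) (θ := fun y => ϑ₂ x y) (fun y => hHk0 y x) (fun y =>
        pow_nonneg (hϑ0 x y) 3) (fun y => hϑ₂pos x y) (hhc x) (hΘ x)) (fun x y => hG x))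
    exact sum_le_sum fun x _ => sum_le_sum fun y _ => sum_le_sum fun z _ =>
      show (Real.sqrt (2 * Hk y x * sV * Q4) / Real.sqrt (ρ x z * ρ x t)) * (ϑ x y * ϑ x z * ϑ x t * ϑ y z * ϑ y t * ϑ z t) ≤ Real.sqrt (2 * sV *
        Q4) * ((ϑ x t ^ 4 / Real.sqrt (ρ x t)) * ((Real.sqrt (Hk y x) * ϑ x y ^ 3) * (ϑ x z ^ 4 / Real.sqrt (ρ x z)))) from
      (interp_pointwise (K := 2 * sV * Q4) (H := Hk y x) (wh := ϑ x y ^ 3) (w₁ := ϑ x z ^ 4) (w₂ := ϑ x t ^ 4) (by ring) hKc (hρ0 x z) (Eq.trans_le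
        (by ring) (route_star34 (hϑ1 x y) (hϑ1 x z) (hϑ1 x t) (hϑ0 y t) (hϑ0 z t) (hm10 y x z) (hm10 y x t) (hm10 z x t)))).trans_eq (by ring)
  have h9 : ∑ x, ∑ y, ∑ z, (Real.sqrt (2 * Hk z x * sV * Q4) / Real.sqrt (ρ x y * ρ x t)) * (ϑ x y * ϑ x z * ϑ x t * ϑ y z * ϑ y t * ϑ z t) ≤
        Real.sqrt (2 * sV * Q4) * (G * (G * Real.sqrt (hcϑ * Θ6))) := by
    refine le_trans ?_ (sum3_le (K := Real.sqrt (2 * sV * Q4)) (a := fun x => ϑ x t ^ 4 / Real.sqrt (ρ x t)) (b := fun x y => ϑ x y ^ 4 / Real.sqrt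
        (ρ x y)) (c := fun x y z => Real.sqrt (Hk z x) * ϑ x z ^ 3) (Real.sqrt_nonneg _) (fun x => div_nonneg (pow_nonneg (hϑ0 x t) 4)
        (Real.sqrt_nonneg _)) (fun x y => div_nonneg (pow_nonneg (hϑ0 x y) 4) (Real.sqrt_nonneg _)) hG0 (Real.sqrt_nonneg _) (hGr t) (fun x => hG
        x) (fun x y => sum_sqrt_mul_le_letters Finset.univ (a := fun z => Hk z x) (c := fun z => ϑ x z ^ 3) (θ := fun z => ϑ₂ x z) (fun z => hHk0 z
        x) (fun z => pow_nonneg (hϑ0 x z) 3) (fun z => hϑ₂pos x z) (hhc x) (hΘ x)))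
    exact sum_le_sum fun x _ => sum_le_sum fun y _ => sum_le_sum fun z _ =>
      show (Real.sqrt (2 * Hk z x * sV * Q4) / Real.sqrt (ρ x y * ρ x t)) * (ϑ x y * ϑ x z * ϑ x t * ϑ y z * ϑ y t * ϑ z t) ≤ Real.sqrt (2 * sV *
        Q4) * ((ϑ x t ^ 4 / Real.sqrt (ρ x t)) * ((ϑ x y ^ 4 / Real.sqrt (ρ x y)) * (Real.sqrt (Hk z x) * ϑ x z ^ 3))) from
      (interp_pointwise (K := 2 * sV * Q4) (H := Hk z x) (wh := ϑ x z ^ 3) (w₁ := ϑ x y ^ 4) (w₂ := ϑ x t ^ 4) (by ring) hKc (hρ0 x y) (Eq.trans_le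
        (by ring) (route_star34 (hϑ1 x z) (hϑ1 x y) (hϑ1 x t) (hϑ0 z t) (hϑ0 y t) (((hm10 y x z)).trans_eq (by ring)) (hm10 z x t) (hm10 y x
        t)))).trans_eq (by ring)
  have h10 : ∑ x, ∑ y, ∑ z, (Real.sqrt (2 * Hk t x * sV * Q4) / Real.sqrt (ρ x y * ρ x z)) * (ϑ x y * ϑ x z * ϑ x t * ϑ y z * ϑ y t * ϑ z t) ≤
        Real.sqrt (2 * sV * Q4) * (Real.sqrt (hrϑ * Θ6) * (G * G)) := by
    refine le_trans ?_ (sum3_le (K := Real.sqrt (2 * sV * Q4)) (a := fun x => Real.sqrt (Hk t x) * ϑ x t ^ 3) (b := fun x y => ϑ x y ^ 4 /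
        Real.sqrt (ρ x y)) (c := fun x y z => ϑ x z ^ 4 / Real.sqrt (ρ x z)) (Real.sqrt_nonneg _) (fun x => mul_nonneg (Real.sqrt_nonneg _)
        (pow_nonneg (hϑ0 x t) 3)) (fun x y => div_nonneg (pow_nonneg (hϑ0 x y) 4) (Real.sqrt_nonneg _)) hG0 hG0 (sum_sqrt_mul_le_letters
        Finset.univ (a := fun x => Hk t x) (c := fun x => ϑ x t ^ 3) (θ := fun x => ϑ₂ x t) (fun x => hHk0 t x) (fun x => pow_nonneg (hϑ0 x t) 3)
        (fun x => hϑ₂pos x t) (hhrr t) (hΘr t)) (fun x => hG x) (fun x y => hG x))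
    exact sum_le_sum fun x _ => sum_le_sum fun y _ => sum_le_sum fun z _ =>
      show (Real.sqrt (2 * Hk t x * sV * Q4) / Real.sqrt (ρ x y * ρ x z)) * (ϑ x y * ϑ x z * ϑ x t * ϑ y z * ϑ y t * ϑ z t) ≤ Real.sqrt (2 * sV *
        Q4) * ((Real.sqrt (Hk t x) * ϑ x t ^ 3) * ((ϑ x y ^ 4 / Real.sqrt (ρ x y)) * (ϑ x z ^ 4 / Real.sqrt (ρ x z)))) from
      (interp_pointwise (K := 2 * sV * Q4) (H := Hk t x) (wh := ϑ x t ^ 3) (w₁ := ϑ x y ^ 4) (w₂ := ϑ x z ^ 4) (by ring) hKc (hρ0 x y) (Eq.trans_le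
        (by ring) (route_star34 (hϑ1 x t) (hϑ1 x y) (hϑ1 x z) (hϑ0 z t) (hϑ0 y z) (((hm10 y x t)).trans_eq (by ring)) (((hm10 z x t)).trans_eq (by
        ring)) (hm10 y x z)))).trans_eq (by ring)
  have h11 : ∑ x, ∑ y, ∑ z, (Real.sqrt (2 * Hk z y * sV * Q4) / Real.sqrt (ρ x y * ρ x t)) * (ϑ x y * ϑ x z * ϑ x t * ϑ y z * ϑ y t * ϑ z t) ≤
        Real.sqrt (2 * sV * Q4) * (G * (G * Real.sqrt (hcϑ * Θ6))) := by
    refine le_trans ?_ (sum3_le (K := Real.sqrt (2 * sV * Q4)) (a := fun x => ϑ x t ^ 4 / Real.sqrt (ρ x t)) (b := fun x y => ϑ x y ^ 4 / Real.sqrt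
        (ρ x y)) (c := fun x y z => Real.sqrt (Hk z y) * ϑ y z ^ 3) (Real.sqrt_nonneg _) (fun x => div_nonneg (pow_nonneg (hϑ0 x t) 4)
        (Real.sqrt_nonneg _)) (fun x y => div_nonneg (pow_nonneg (hϑ0 x y) 4) (Real.sqrt_nonneg _)) hG0 (Real.sqrt_nonneg _) (hGr t) (fun x => hG
        x) (fun x y => sum_sqrt_mul_le_letters Finset.univ (a := fun z => Hk z y) (c := fun z => ϑ y z ^ 3) (θ := fun z => ϑ₂ y z) (fun z => hHk0 z
        y) (fun z => pow_nonneg (hϑ0 y z) 3) (fun z => hϑ₂pos y z) (hhc y) (hΘ y)))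
    exact sum_le_sum fun x _ => sum_le_sum fun y _ => sum_le_sum fun z _ =>
      show (Real.sqrt (2 * Hk z y * sV * Q4) / Real.sqrt (ρ x y * ρ x t)) * (ϑ x y * ϑ x z * ϑ x t * ϑ y z * ϑ y t * ϑ z t) ≤ Real.sqrt (2 * sV *
        Q4) * ((ϑ x t ^ 4 / Real.sqrt (ρ x t)) * ((ϑ x y ^ 4 / Real.sqrt (ρ x y)) * (Real.sqrt (Hk z y) * ϑ y z ^ 3))) from
      (interp_pointwise (K := 2 * sV * Q4) (H := Hk z y) (wh := ϑ y z ^ 3) (w₁ := ϑ x y ^ 4) (w₂ := ϑ x t ^ 4) (by ring) hKc (hρ0 x y) (Eq.trans_le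
        (by ring) (route_path34 (hϑ1 y z) (hϑ1 x y) (hϑ1 x t) (hϑ0 y t) (hϑ0 z t) (((hm00 x y z)).trans_eq (by ring)) (hm10 y x t) ((hm10 z y
        t).trans (mul_le_mul_of_nonneg_left (hm10 y x t) (hϑ0 _ _)))))).trans_eq (by ring)
  have h12 : ∑ x, ∑ y, ∑ z, (Real.sqrt (2 * Hk t y * sV * Q4) / Real.sqrt (ρ x y * ρ x z)) * (ϑ x y * ϑ x z * ϑ x t * ϑ y z * ϑ y t * ϑ z t) ≤
        Real.sqrt (2 * sV * Q4) * (Real.sqrt (hrϑ * Θ6) * (G * G)) := by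
    refine (sum3_perm_213 Finset.univ fun x y z => (Real.sqrt (2 * Hk t y * sV * Q4) / Real.sqrt (ρ x y * ρ x z)) * (ϑ x y * ϑ x z * ϑ x t * ϑ y z
        * ϑ y t * ϑ z t)).trans_le ?_
    refine le_trans ?_ (sum3_le (K := Real.sqrt (2 * sV * Q4)) (a := fun y => Real.sqrt (Hk t y) * ϑ y t ^ 3) (b := fun y x => ϑ x y ^ 4 /
        Real.sqrt (ρ x y)) (c := fun y x z => ϑ x z ^ 4 / Real.sqrt (ρ x z)) (Real.sqrt_nonneg _) (fun y => mul_nonneg (Real.sqrt_nonneg _)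
        (pow_nonneg (hϑ0 y t) 3)) (fun y x => div_nonneg (pow_nonneg (hϑ0 x y) 4) (Real.sqrt_nonneg _)) hG0 hG0 (sum_sqrt_mul_le_letters
        Finset.univ (a := fun y => Hk t y) (c := fun y => ϑ y t ^ 3) (θ := fun y => ϑ₂ y t) (fun y => hHk0 t y) (fun y => pow_nonneg (hϑ0 y t) 3)
        (fun y => hϑ₂pos y t) (hhrr t) (hΘr t)) (fun y => hGr y) (fun y x => hG x))
    exact sum_le_sum fun y _ => sum_le_sum fun x _ => sum_le_sum fun z _ =>
      show (Real.sqrt (2 * Hk t y * sV * Q4) / Real.sqrt (ρ x y * ρ x z)) * (ϑ x y * ϑ x z * ϑ x t * ϑ y z * ϑ y t * ϑ z t) ≤ Real.sqrt (2 * sV *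
        Q4) * ((Real.sqrt (Hk t y) * ϑ y t ^ 3) * ((ϑ x y ^ 4 / Real.sqrt (ρ x y)) * (ϑ x z ^ 4 / Real.sqrt (ρ x z)))) from
      (interp_pointwise (K := 2 * sV * Q4) (H := Hk t y) (wh := ϑ y t ^ 3) (w₁ := ϑ x y ^ 4) (w₂ := ϑ x z ^ 4) (by ring) hKc (hρ0 x y) (Eq.trans_le
        (by ring) (route_path34 (hϑ1 y t) (hϑ1 x y) (hϑ1 x z) (hϑ0 y z) (hϑ0 z t) (((hm00 x y t)).trans_eq (by ring)) (hm10 y x z) ((((hm10 z y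
        t).trans (mul_le_mul_of_nonneg_right (hm10 y x z) (hϑ0 _ _)))).trans_eq (by ring))))).trans_eq (by ring)
  have h13 : ∑ x, ∑ y, ∑ z, (Real.sqrt (2 * Hk t z * sV * Q4) / Real.sqrt (ρ x z * ρ x y)) * (ϑ x y * ϑ x z * ϑ x t * ϑ y z * ϑ y t * ϑ z t) ≤
        Real.sqrt (2 * sV * Q4) * (Real.sqrt (hrϑ * Θ6) * (G * G)) := by
    refine (sum3_perm_312 Finset.univ fun x y z => (Real.sqrt (2 * Hk t z * sV * Q4) / Real.sqrt (ρ x z * ρ x y)) * (ϑ x y * ϑ x z * ϑ x t * ϑ y z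
        * ϑ y t * ϑ z t)).trans_le ?_
    refine le_trans ?_ (sum3_le (K := Real.sqrt (2 * sV * Q4)) (a := fun z => Real.sqrt (Hk t z) * ϑ z t ^ 3) (b := fun z x => ϑ x z ^ 4 /
        Real.sqrt (ρ x z)) (c := fun z x y => ϑ x y ^ 4 / Real.sqrt (ρ x y)) (Real.sqrt_nonneg _) (fun z => mul_nonneg (Real.sqrt_nonneg _)
        (pow_nonneg (hϑ0 z t) 3)) (fun z x => div_nonneg (pow_nonneg (hϑ0 x z) 4) (Real.sqrt_nonneg _)) hG0 hG0 (sum_sqrt_mul_le_letters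
        Finset.univ (a := fun z => Hk t z) (c := fun z => ϑ z t ^ 3) (θ := fun z => ϑ₂ z t) (fun z => hHk0 t z) (fun z => pow_nonneg (hϑ0 z t) 3)
        (fun z => hϑ₂pos z t) (hhrr t) (hΘr t)) (fun z => hGr z) (fun z x => hG x))
    exact sum_le_sum fun z _ => sum_le_sum fun x _ => sum_le_sum fun y _ =>
      show (Real.sqrt (2 * Hk t z * sV * Q4) / Real.sqrt (ρ x z * ρ x y)) * (ϑ x y * ϑ x z * ϑ x t * ϑ y z * ϑ y t * ϑ z t) ≤ Real.sqrt (2 * sV *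
        Q4) * ((Real.sqrt (Hk t z) * ϑ z t ^ 3) * ((ϑ x z ^ 4 / Real.sqrt (ρ x z)) * (ϑ x y ^ 4 / Real.sqrt (ρ x y)))) from
      (interp_pointwise (K := 2 * sV * Q4) (H := Hk t z) (wh := ϑ z t ^ 3) (w₁ := ϑ x z ^ 4) (w₂ := ϑ x y ^ 4) (by ring) hKc (hρ0 x z) (Eq.trans_le
        (by ring) (route_path34 (hϑ1 z t) (hϑ1 x z) (hϑ1 x y) (hϑ0 y z) (hϑ0 y t) (((hm00 x z t)).trans_eq (by ring)) (((hm10 y x z)).trans_eq (by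
        ring)) ((((hm00 y z t).trans (mul_le_mul_of_nonneg_right (hm10 y x z) (hϑ0 _ _)))).trans_eq (by ring))))).trans_eq (by ring)
  have h14 : ∑ x, ∑ y, ∑ z, (Ct * ((r x y ^ 2)⁻¹ * (r x z ^ 2)⁻¹ * (r x t ^ 2)⁻¹ + (r x y ^ 2)⁻¹ * (r y z ^ 2)⁻¹ * (r y t ^ 2)⁻¹ + (r x z ^ 2)⁻¹ *
        (r y z ^ 2)⁻¹ * (r z t ^ 2)⁻¹ + (r x t ^ 2)⁻¹ * (r y t ^ 2)⁻¹ * (r z t ^ 2)⁻¹ + (r x y ^ 2)⁻¹ * (r y z ^ 2)⁻¹ * (r z t ^ 2)⁻¹ + (r x y ^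
        2)⁻¹ * (r y t ^ 2)⁻¹ * (r z t ^ 2)⁻¹ + (r x z ^ 2)⁻¹ * (r y z ^ 2)⁻¹ * (r y t ^ 2)⁻¹ + (r x z ^ 2)⁻¹ * (r y t ^ 2)⁻¹ * (r z t ^ 2)⁻¹ + (r x
        t ^ 2)⁻¹ * (r y z ^ 2)⁻¹ * (r y t ^ 2)⁻¹ + (r x t ^ 2)⁻¹ * (r y z ^ 2)⁻¹ * (r z t ^ 2)⁻¹ + (r x y ^ 2)⁻¹ * (r x z ^ 2)⁻¹ * (r z t ^ 2)⁻¹ +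
        (r x y ^ 2)⁻¹ * (r x t ^ 2)⁻¹ * (r z t ^ 2)⁻¹ + (r x y ^ 2)⁻¹ * (r x z ^ 2)⁻¹ * (r y t ^ 2)⁻¹ + (r x z ^ 2)⁻¹ * (r x t ^ 2)⁻¹ * (r y t ^
        2)⁻¹ + (r x y ^ 2)⁻¹ * (r x t ^ 2)⁻¹ * (r y z ^ 2)⁻¹ + (r x z ^ 2)⁻¹ * (r x t ^ 2)⁻¹ * (r y z ^ 2)⁻¹)) * (ϑ x y * ϑ x z * ϑ x t * ϑ y z * ϑ
        y t * ϑ z t) ≤ Ct * (16 * S4 ^ 3) := by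
    have e : Ct * (∑ x, ∑ y, ∑ z, ((r x y ^ 2)⁻¹ * (r x z ^ 2)⁻¹ * (r x t ^ 2)⁻¹ + (r x y ^ 2)⁻¹ * (r y z ^ 2)⁻¹ * (r y t ^ 2)⁻¹ + (r x z ^ 2)⁻¹ *
        (r y z ^ 2)⁻¹ * (r z t ^ 2)⁻¹ + (r x t ^ 2)⁻¹ * (r y t ^ 2)⁻¹ * (r z t ^ 2)⁻¹ + (r x y ^ 2)⁻¹ * (r y z ^ 2)⁻¹ * (r z t ^ 2)⁻¹ + (r x y ^
        2)⁻¹ * (r y t ^ 2)⁻¹ * (r z t ^ 2)⁻¹ + (r x z ^ 2)⁻¹ * (r y z ^ 2)⁻¹ * (r y t ^ 2)⁻¹ + (r x z ^ 2)⁻¹ * (r y t ^ 2)⁻¹ * (r z t ^ 2)⁻¹ + (r x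
        t ^ 2)⁻¹ * (r y z ^ 2)⁻¹ * (r y t ^ 2)⁻¹ + (r x t ^ 2)⁻¹ * (r y z ^ 2)⁻¹ * (r z t ^ 2)⁻¹ + (r x y ^ 2)⁻¹ * (r x z ^ 2)⁻¹ * (r z t ^ 2)⁻¹ +
        (r x y ^ 2)⁻¹ * (r x t ^ 2)⁻¹ * (r z t ^ 2)⁻¹ + (r x y ^ 2)⁻¹ * (r x z ^ 2)⁻¹ * (r y t ^ 2)⁻¹ + (r x z ^ 2)⁻¹ * (r x t ^ 2)⁻¹ * (r y t ^
        2)⁻¹ + (r x y ^ 2)⁻¹ * (r x t ^ 2)⁻¹ * (r y z ^ 2)⁻¹ + (r x z ^ 2)⁻¹ * (r x t ^ 2)⁻¹ * (r y z ^ 2)⁻¹) * (ϑ x y * ϑ x z * ϑ x t * ϑ y z * ϑ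
        y t * ϑ z t)) = ∑ x, ∑ y, ∑ z, Ct * ((r x y ^ 2)⁻¹ * (r x z ^ 2)⁻¹ * (r x t ^ 2)⁻¹ + (r x y ^ 2)⁻¹ * (r y z ^ 2)⁻¹ * (r y t ^ 2)⁻¹ + (r x z
        ^ 2)⁻¹ * (r y z ^ 2)⁻¹ * (r z t ^ 2)⁻¹ + (r x t ^ 2)⁻¹ * (r y t ^ 2)⁻¹ * (r z t ^ 2)⁻¹ + (r x y ^ 2)⁻¹ * (r y z ^ 2)⁻¹ * (r z t ^ 2)⁻¹ + (r
        x y ^ 2)⁻¹ * (r y t ^ 2)⁻¹ * (r z t ^ 2)⁻¹ + (r x z ^ 2)⁻¹ * (r y z ^ 2)⁻¹ * (r y t ^ 2)⁻¹ + (r x z ^ 2)⁻¹ * (r y t ^ 2)⁻¹ * (r z t ^ 2)⁻¹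
        + (r x t ^ 2)⁻¹ * (r y z ^ 2)⁻¹ * (r y t ^ 2)⁻¹ + (r x t ^ 2)⁻¹ * (r y z ^ 2)⁻¹ * (r z t ^ 2)⁻¹ + (r x y ^ 2)⁻¹ * (r x z ^ 2)⁻¹ * (r z t ^
        2)⁻¹ + (r x y ^ 2)⁻¹ * (r x t ^ 2)⁻¹ * (r z t ^ 2)⁻¹ + (r x y ^ 2)⁻¹ * (r x z ^ 2)⁻¹ * (r y t ^ 2)⁻¹ + (r x z ^ 2)⁻¹ * (r x t ^ 2)⁻¹ * (r y
        t ^ 2)⁻¹ + (r x y ^ 2)⁻¹ * (r x t ^ 2)⁻¹ * (r y z ^ 2)⁻¹ + (r x z ^ 2)⁻¹ * (r x t ^ 2)⁻¹ * (r y z ^ 2)⁻¹) * (ϑ x y * ϑ x z * ϑ x t * ϑ y z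
        * ϑ y t * ϑ z t) := by
      rw [mul_sum]; refine sum_congr rfl fun _ _ => ?_; rw [mul_sum]; refine sum_congr rfl fun _ _ => ?_; rw [mul_sum]
      exact sum_congr rfl fun _ _ => (mul_assoc _ _ _).symm
    rw [← e]
    exact mul_le_mul_of_nonneg_left (weighted_tree16_slot_four hϑ1 hϑsymm hϑmul hrsymm hS4 t) hCt
  simp (config := { maxSteps := 4000000 }) only [add_mul, sum_add_distrib]
  linarith [h0, h1, h2, h3, h4, h5, h6, h7, h8, h9, h10, h11, h12, h13, h14]

/-! ## Toy -/

/-- Toy (the crossing count on numbers): a `K4⊗Hk` term has three crossing pairs, a `K3⊗K3` term four: `3 + 4 = 7 ≤ 2·4`. -/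
example : (3 : ℕ) + 4 ≤ 2 * 4 := by norm_num

end Summit.QuantumFields.BalabanUV.T4Continuum.NE7b.SupWeightedFourthOrderLettersFour

end
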